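import Summits.QuantumFields.YangMills.Theorems.BalabanUVNodesN15PerCubeGreenJetBoth
import Summits.QuantumFields.YangMills.Theorems.BalabanUVNodesN15PerCubeGreenAdjointGreen
import HarnessLib

/-!
# N15 = NE2, road (c) — PROGRAMME (PC): THE CONSUMER-FACING STATEMENT OF (PC-A)+(PC-A′)+(PC-A″) — entries `G′(U)`, `∇_UG′(U)` (all `μ`), `G′(U)∇*_U` (all `ν`, and bond → site)
# of [B9] (3.42) for the NAMED `G′(U) = cGreen (cvT e U) a` from ONE two-collar `Reg335Cube` datum per cube, ONE set of constants (dag-n15-c g27, n15-c∕288)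

Cell `pub-ymgap`, seat `pub-ymgap-dag-n15-c` (generation g27; R134 (a), s1; HUMAN RULING D-0062).  `bears_on: R4∕N15 · K3⁸ SpineGivenEndpointR13SepCoPHV (stmt-QuantumFields-27366)`;
filed `--kind proof --supports stmt-QuantumFields-27366 --as helper` — COUNT-NEUTRAL.  One theorem, 0 `def`, 0 `sorry`; bookkeeping of constants only (`min` of rates∕radii, `max`
of thresholds).  Imports BY NAME n15-c∕278 `…PerCubeGreenJetBoth` (`hasMaj_cGreen_jet_of_reg335Box2`: entries 0 and 2) and n15-c∕286 `…PerCubeGreenAdjointGreen`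
(`hasMaj_cGreen_adjGrad_of_reg335Box`: entry 3).  Nothing in the tree is modified.  GENERATED (term macros) by the seat's `gen/buildA7.py`.

HONEST FRAMING ∕ LIMITS.  Packaging only; MODEL carriers (doubled-cube torus cover, one scale, King's window); the SHAPES of [B9] Thm 3.1 (3.42) ∕ Thm 3.7 ∕ Cor. 3.6 for the named
`G′(U)` in the printed per-cube class, NOT the printed theorem; nothing of [B5]∕[B6]∕[B9] asserted.  NE2⁺ NOT PRINTED, NOT proved; N15 of record untouched (DISCHARGED AS CONSUMED,
p687738); K3⁸ OPEN; counts of record UNMOVED (typed 28∕28 · discharged 8∕27); one finite 𝕋⁴ at fixed ε per index — NOT infinite volume, NOT OS on ℝ⁴, NOT a mass gap, NOT Clay.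
Restate-immune (no Theses import).
-/

noncomputable section

open scoped BigOperators Matrix Matrix.Norms.L2Operator

namespace Summit.QuantumFields.YangMills.BalabanUVNodes.N15.Gluing

open Real
open Literature.MathematicalPhysics.QuantumFieldTheory.Balaban1983to89
open Literature.MathematicalPhysics.QuantumFieldTheory.Balaban1983to89.B5Prop11Plancherel (Tor fine unitVec)
open Literature.MathematicalPhysics.QuantumFieldTheory.Balaban1983to89.B11SectG (BlockNorm HasMaj)
open Literature.MathematicalPhysics.QuantumFieldTheory.Balaban1983to89.T4EtaRateCoeffDefect (pull)
open Literature.MathematicalPhysics.QuantumFieldTheory.Balaban1983to89.B6UnitTorusCarrier (unitTorusGeo unitTorusGeo_dist_nonneg)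
open Literature.MathematicalPhysics.QuantumFieldTheory.Balaban1983to89.B9Eq335RegularityClasses (Reg335Cube)
open Literature.MathematicalPhysics.QuantumFieldTheory.King1986 (aK aK_pos)
open Literature.MathematicalPhysics.QuantumFieldTheory.King1986.Torus (blockOf)
open Literature.Barriers.QuantumFields (traceForm)
open Summit.QuantumFields.YangMills.BalabanUVNodes.N15.MatrixSpecies (mmulOp coordMat basisConst liftEquiv liftBlk covD)
open Summit.QuantumFields.YangMills.BalabanUVNodes.N15.TwoGrid (chiCube cubeBlocks)
open Summit.QuantumFields.YangMills.BalabanUVNodes.N15.CovLandau (cgrad cGreen)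

variable {d : ℕ}

section Green

variable {L : ℕ} [NeZero L]

/-- ★★★★ **ENTRIES `G′(U)`, `∇_UG′(U)`, `G′(U)∇*_U` OF (3.42) FOR THE NAMED `G′(U)` AND EVERY `U(m)` FIELD IN THE PRINTED CLASS (3.35) PER CUBE, ONE SET OF CONSTANTS** (n15-c∕278 ∧ n15-c∕286
at the common rate `δ = min`, threshold `w₀ = max`, radius `R₀ = min`).  MODEL carriers; the SHAPE of [B9] Thm 3.1 (3.42), NOT the printed theorem.
[cite: Balaban1985BackgroundPropagators, Thm 3.1 (3.42) p.397, Thm 3.7 (3.90) p.409, Cor. 3.6 p.408, (3.34)–(3.35) p.396 (shape ∕ mechanism); Balaban1984PropagatorsII, (2.91)–(2.93) p.239, (2.133)–(2.136) p.247] -/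
theorem hasMaj_cGreen_all_of_reg335Box2 (hL : Odd L ∧ 1 < L) (hL7 : 7 ≤ L) {a₀ : ℝ} (ha₀ : 0 < a₀) (ι : Type) [Fintype ι] [DecidableEq ι] :
    ∃ δ w₀ R₀ B₀ B₂ cJ B₃ : ℝ, 0 < δ ∧ 0 < R₀ ∧ 0 < B₀ ∧ 0 < B₂ ∧ 0 ≤ cJ ∧ 0 ≤ B₃ ∧
      ∀ (mv kk : ℕ), 1 ≤ kk → w₀ ≤ ((L ^ mv : ℕ) : ℝ) →
      ∀ {mm : Type} [Fintype mm] [DecidableEq mm] [Nonempty mm] (e : Matrix mm mm ℂ ≃L[ℝ] (ι → ℝ)), (∀ A B : Matrix mm mm ℂ, traceForm A B = e A ⬝ᵥ e B) →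
      ∀ (U : Fin (d + 1) → ScX d L mv kk hL → (Matrix mm mm ℂ)ˣ), (∀ μ x, (U μ x : Matrix mm mm ℂ) ∈ Matrix.unitaryGroup mm ℂ) →
      ∀ (ξ C : ℝ), 0 < ξ → 0 ≤ C → (∀ k, Reg335Cube (scShift d L mv kk hL) U ((((L ^ kk : ℕ) : ℝ))⁻¹) {x : ScX d L mv kk hL | blockOf (L ^ kk) (cvM d L mv kk hL) x ∈ cubeBlocks (cvM d L mv kk hL) (coverCorner (cvM d L mv kk hL) (L ^ mv) L (2 * L ^ mv + 2) k) (6 * L ^ mv + 5)} ξ C) →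
      ∀ (rV : ℝ), 0 ≤ rV → Fintype.card ι * (@basisConst ι _ (Matrix mm mm ℂ) Matrix.frobeniusNormedAddCommGroup Matrix.frobeniusNormedSpace e * (2 * Real.sqrt (Fintype.card mm)) * (Real.sqrt (Fintype.card mm) * ((C / ξ) * Real.exp (((((L ^ kk : ℕ) : ℝ))⁻¹) * (C / ξ))))) ≤ rV → Fintype.card ι * (Fintype.card (Fin (d + 1)) * (Fintype.card ι * (@basisConst ι _ (Matrix mm mm ℂ) Matrix.frobeniusNormedAddCommGroup Matrix.frobeniusNormedSpace e * (2 * Real.sqrt (Fintype.card mm)) * (Real.sqrt (Fintype.card mm) * ((C / ξ) * Real.exp (((((L ^ kk : ℕ) : ℝ))⁻¹) * (C / ξ))))) ^ 2 + (@basisConst ι _ (Matrix mm mm ℂ) Matrix.frobeniusNormedAddCommGroup Matrix.frobeniusNormedSpace e * (2 * Real.sqrt (Fintype.card mm)) * (Real.sqrt (Fintype.card mm) * ((C / ξ ^ 2) * Real.exp (((((L ^ kk : ℕ) : ℝ))⁻¹) * (C / ξ))))))) ≤ rV → Fintype.card ι * (@basisConst ι _ (Matrix mm mm ℂ) Matrix.frobeniusNormedAddCommGroup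 Matrix.frobeniusNormedSpace e * (2 * Real.sqrt (Fintype.card mm)) * (Real.sqrt (Fintype.card mm) * ((C / ξ ^ 2) * Real.exp (((((L ^ kk : ℕ) : ℝ))⁻¹) * (C / ξ))))) ≤ rV →
        rV * (1 + Fintype.card (Fin (d + 1) ⊕ Fin (d + 1))) + a₀ * (Fintype.card ι * (Fintype.card ι * ((1 + rV * ((((L ^ kk : ℕ) : ℝ))⁻¹)) ^ ((d + 1) * L ^ kk) - 1) ^ 2 + 2 * ((1 + rV * ((((L ^ kk : ℕ) : ℝ))⁻¹)) ^ ((d + 1) * L ^ kk) - 1))) ≤ R₀ →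
      HasMaj (ScNorm d L mv kk hL ι) (ScNorm d L mv kk hL ι) (Matrix.mulVecLin (cGreen (cvM d L mv kk hL) (L ^ kk) (cvT e (fun μ x => (U μ x : Matrix mm mm ℂ))) (aK a₀ (L : ℝ) kk * (((L ^ kk : ℕ) : ℝ)) ^ (d + 1)))) (fun y y' => B₀ * Real.exp (-(δ / 16 * (unitTorusGeo L kk (cvM d L mv kk hL)).dist y y'))) ∧
      (∀ μ : Fin (d + 1), HasMaj (ScNorm d L mv kk hL ι) (ScNorm d L mv kk hL ι) (pull (fun p : ScX d L mv kk hL × ι => ((p.1, μ), p.2)) ∘ₗ Matrix.mulVecLin ((cgrad (cvM d L mv kk hL) (L ^ kk) (cvT e (fun μ x => (U μ x : Matrix mm mm ℂ)))) * (cGreen (cvM d L mv kk hL) (L ^ kk) (cvT e (fun μ x => (U μ x : Matrix mm mm ℂ))) (aK a₀ (L : ℝ) kk * (((L ^ kk : ℕ) : ℝ)) ^ (d + 1)))))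
          (fun y y' => (1 * (1 + rV * cJ) + π) * B₂ * Real.exp (-(δ / 16 * (unitTorusGeo L kk (cvM d L mv kk hL)).dist y y')))) ∧
      (∀ ν : Fin (d + 1), HasMaj (ScNorm d L mv kk hL ι) (ScNorm d L mv kk hL ι) (Matrix.mulVecLin (cGreen (cvM d L mv kk hL) (L ^ kk) (cvT e (fun μ x => (U μ x : Matrix mm mm ℂ))) (aK a₀ (L : ℝ) kk * (((L ^ kk : ℕ) : ℝ)) ^ (d + 1))) ∘ₗ covD ((((L ^ kk : ℕ) : ℝ))⁻¹) (fun y => ((cvT e (fun μ x => (U μ x : Matrix mm mm ℂ))) ν (((scShift d L mv kk hL) ν).symm y))ᵀ) ⇑((scShift d L mv kk hL) ν).symm)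
          (fun y y' => B₃ * (1 + rV) * Real.exp (-(δ / 16 * (unitTorusGeo L kk (cvM d L mv kk hL)).dist y y')))) ∧
      HasMaj (BlockNorm.ofBlocks (unitTorusGeo L kk (cvM d L mv kk hL)) (liftBlk (fun b : ScX d L mv kk hL × Fin (d + 1) => blockOf (L ^ kk) (cvM d L mv kk hL) b.1) ι)) (ScNorm d L mv kk hL ι) (Matrix.mulVecLin ((cGreen (cvM d L mv kk hL) (L ^ kk) (cvT e (fun μ x => (U μ x : Matrix mm mm ℂ))) (aK a₀ (L : ℝ) kk * (((L ^ kk : ℕ) : ℝ)) ^ (d + 1))) * (cgrad (cvM d L mv kk hL) (L ^ kk) (cvT e (fun μ x => (U μ x : Matrix mm mm ℂ))))ᵀ)) (fun y y' => ((d : ℝ) + 1) * (B₃ * (1 + rV)) * Real.exp (-(δ / 16 * (unitTorusGeo L kk (cvM d L mv kk hL)).dist y y'))) := by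
  obtain ⟨δ₁, w₁, R₁, B₀, B₂, cJ, hδ₁, hR₁, hB₀, hB₂, hcJ, H1⟩ := hasMaj_cGreen_jet_of_reg335Box2 (d := d) hL hL7 ha₀ ι
  obtain ⟨δ₃, w₃, R₃, B₃, hδ₃, hR₃, hB₃, H3⟩ := hasMaj_cGreen_adjGrad_of_reg335Box (d := d) hL hL7 ha₀ ι
  refine ⟨min δ₁ δ₃, max w₁ w₃, min R₁ R₃, B₀, B₂, cJ, B₃, lt_min hδ₁ hδ₃, lt_min hR₁ hR₃, hB₀, hB₂, hcJ, hB₃, fun mv kk hk hw₀ => ?_⟩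
  intro mm _ _ _ e he U hU ξ C hξ hC h335 rV hrV hrA hrC hrQ hRle
  have hw₁ : w₁ ≤ ((L ^ mv : ℕ) : ℝ) := (le_max_left _ _).trans hw₀
  have hw₃ : w₃ ≤ ((L ^ mv : ℕ) : ℝ) := (le_max_right _ _).trans hw₀
  have hd0 : ∀ y y', 0 ≤ (unitTorusGeo L kk (cvM d L mv kk hL)).dist y y' := fun y y' => unitTorusGeo_dist_nonneg L kk _ y y'
  have hrate₁ : ∀ (c : ℝ), 0 ≤ c → ∀ y y', c * Real.exp (-(δ₁ / 16 * (unitTorusGeo L kk (cvM d L mv kk hL)).dist y y')) ≤ c * Real.exp (-(min δ₁ δ₃ / 16 * (unitTorusGeo L kk (cvM d L mv kk hL)).dist y y')) := fun c hc y y' => by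
    refine mul_le_mul_of_nonneg_left (Real.exp_le_exp.mpr ?_) hc
    have := mul_le_mul_of_nonneg_right (min_le_left δ₁ δ₃) (hd0 y y')
    linarith
  have hrate₃ : ∀ (c : ℝ), 0 ≤ c → ∀ y y', c * Real.exp (-(δ₃ / 16 * (unitTorusGeo L kk (cvM d L mv kk hL)).dist y y')) ≤ c * Real.exp (-(min δ₁ δ₃ / 16 * (unitTorusGeo L kk (cvM d L mv kk hL)).dist y y')) := fun c hc y y' => by
    refine mul_le_mul_of_nonneg_left (Real.exp_le_exp.mpr ?_) hc
    have := mul_le_mul_of_nonneg_right (min_le_right δ₁ δ₃) (hd0 y y')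
    linarith
  obtain ⟨h0, h2⟩ := H1 mv kk hk hw₁ e he U hU ξ C hξ hC h335 rV hrV hrA hrC (hRle.trans (min_le_left _ _))
  obtain ⟨h3, h3b⟩ := H3 mv kk hk hw₃ e he U hU ξ C hξ hC h335 rV hrV hrA hrC hrQ (hRle.trans (min_le_right _ _))
  exact ⟨h0.mono (hrate₁ _ hB₀.le), fun μ => (h2 μ).mono (hrate₁ _ (by positivity)), fun ν => (h3 ν).mono (hrate₃ _ (by positivity)), h3b.mono (hrate₃ _ (by positivity))⟩

end Green

end Summit.QuantumFields.YangMills.BalabanUVNodes.N15.Gluing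

end
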